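/-
Copyright (c) 2026 the pub-hodgecm-mathlib formalisation cell (harness21).  Prover seat hodgecm-mathlib-K2Liu-p05 (g2), 2026-09-04
(Track B «K2-LIT», crux hLiu418 = stmt-HodgeConjecture-24832, organ (L24-c) of socket #24i∕#30i `sig_K2LiuThetaTypeSphericalEigenvalueInert`,
LEAD F0P6-plan (g11) deal 05:01:57Z (ii), LEAD BOX 05:10:24Z PASS).
-/
import Summits.HodgeConjecture.HodgeConjecture.Theorems.K2LiuThetaTypeInertGlobalAssembly        -- ★ (this seat) inert global assembly, hloc from the line, pull-back
import Summits.HodgeConjecture.HodgeConjecture.Theorems.K2LiuInertWeilSphericalLineFrameDock     -- ★ (this seat) (L24-a) line with #24i binders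
import Literature.NumberTheory.Automorphic.Liu2021.SplitPlaceHeckeEigenvaluesAtLine              -- ★ `congrW_undoubledSplittings_cmFinLocalFamily_s` currency, `cmFinLocalFamily`, `borelPlaceMeasure`
import Literature.NumberTheory.Automorphic.Liu2021.LemD1SplitPlaceHeckeEigenvaluesChain           -- ★ #30a∕#24i θ-type vocabulary (`toHeckeCharacter`, `isCompatible_chiSplittingLine`, `TW`, `JW`)
import HarnessLib

/-!
# (L24-c): socket #24i `sig_K2LiuThetaTypeSphericalEigenvalueInert` ASSEMBLED MODULO THE UPSTAIRS HECKE COMPUTATION (Σ)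

Topic: crux hLiu418 (stmt-HodgeConjecture-24832), Track B «K2-LIT», socket #24i∕#30i `sig_K2LiuThetaTypeSphericalEigenvalueInert`
(`Cruxes/HLiu418/Lines/K2_Liu_CurveThetaSigs_U5e_InertSeam.lean` ED. 2 :258, tree 0af35c0e8c96fba5), organ (L24-c) «assembly» (LEAD F0P6-plan (g11) deal
05:01:57Z (ii); census `K2/K2Liu-p05/g2/CENSUS-L24c-24iCloser.K2Liup05g2.md`, LEAD BOX 05:10:24Z PASS).  Namespace
`Summit.HodgeConjecture.HodgeConjecture.Cruxes.HLiu418.K2LiuThetaTypeSphericalEigenvalueInertOfUpstairs`.  THEOREMS ONLY (no definition, no named fact, no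
instance, no notation, no `sorry`); `--supports stmt-HodgeConjecture-24832 --as helper`; count-neutral.

THE STATEMENT.  `thetaTypeSphericalEigenvalueInert_of_upstairs : ‹(Σ)› → ‹#24i :258–:302›` — the socket's statement VERBATIM (θ-block of ★ #30a at
`H := diagonal dV`, `Function.Injective j`, `∃ S₀ finite`, #28i's place∕frame∕generator block, `K` hyperspecial, conclusion
`heckeOperator σ K (ι_v t₁) y = (q(Z + Z⁻¹) + q − 1) • y`, `Z := (toHeckeCharacter L lam).valueAtUniformizer w.1`) as a CONSEQUENCE of ONE hypothesis (Σ), the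
UPSTAIRS Hecke computation on the spherical vector of the local Weil representation (organ (L24-b), K2Liu-p01 (g4)): off a finite set of places and under the
same place∕frame∕generator block, `[U(𝒪_v) t₁ U(𝒪_v)] 1_{𝒪_v^{n′}} = (q(Z + Z⁻¹) + q − 1) • 1_{𝒪_v^{n′}}` for the pulled-back Weil representation
`ω_v ∘ localLineInl v` of `U(diag dV)(L⁺_v)` on `𝒮(L⁺_v^{n′})`, `ω_v = (congrW … (undoubledSplittings … θ (borelPlaceMeasure L) (cmFinLocalFamily … θ …))).omegaLoc v`,
`θ = toHeckeCharacter L lam` (the S4c-H place-`v` carrier; ★ `congrW_undoubledSplittings_cmFinLocalFamily_s` reads its splitting as `localSplittingCM …`).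

THE PROOF (all organs ★): S₀ := S_Σ ∪ {places over the finitely many `v` where a side condition fails} — `2 ∈ 𝒪_v^×`, `imagUnit L` a unit above `v`, `ψ_v` of
conductor `𝒪_v`, `𝕋₀_v` integral (★ §7 of `K2LiuInertWeilSphericalLineFrame`), `U(𝒪_v)` fixes `1_{𝒪ⁿ′}` (★ Ω1 `FinLocalSplittings.unitVec_mem_fixedPoints`), `a` a unit
above `v` (★ `eventually_valued_algebraMap_eq_one` + ★ `eventually_forall_placesOver`), finitely many `w` over these (★ `tendsto_placesOver_cofinite`).  At a good
inert `w ∣ v`: (L24-a) ★ `fixedPoints_twistedCoinv_omegaLoc_comp_localLineInl_le_span_inert` gives the LINE `Θ̃_v^{U(𝒪_v)} ≤ ℂ ∙ [1]` for the place-`v` θ-factor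
`Θ̃_v = (TwistedCoinv.rep χ_v ω_v _) ∘ localLineInl v`; with (Σ) ★ `heckeOperator_apply_eq_smul_of_fixedPoints_le_span` turns it into the local eigen-equation
`hloc`; ★ `rhoVAtLine_heckeOperator_inclPlace_apply_eq_smul` (S4c-H `⊗'` + hyperspecial glue) globalises it to `(ω⋆)^K`; ★ `heckeOperator_inclPlace_apply_eq_smul_of_injective`
pulls it back along the injective `j : σ ↪ ω⋆`.  What remains for the by-value closer of #24i: discharge (Σ) by K2Liu-p01 (g4)'s `K2LiuInertThetaSphericalEigenvalue`
head (+ ★ `HeckeCharacter.localComponent_eq_valueAtUniformizer` for the `Z` currency, + ★ `congrW_undoubledSplittings_cmFinLocalFamily_s` for the splitting currency).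

HONEST LABEL: HC_CM is proved only modulo the 7 printed citations (2 remaining named inputs: hLiu418 = stmt-HodgeConjecture-24832, h413 =
stmt-HodgeConjecture-24833) until rung 0 closes; this file is #24i MODULO (Σ), a count-neutral helper; it closes nothing by itself.

## References
* [Liu2021] Y. Liu, Camb. J. Math. 9 (2021), Def. 4.11 (l. 2083–2097), App. D §D.1, Lem. D.1 (l. 5226–5233).
* [GelbartRogawski1991] S. Gelbart, J. Rogawski, Invent. Math. 105 (1991), §3 pp. 455–459.
* [CartierCorvallis1979] P. Cartier, PSPM 33.1 (1979), §IV.1.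
* [MoeglinVignerasWaldspurger1987] C. Mœglin, M.-F. Vignéras, J.-L. Waldspurger, LNM 1291 (1987), Chap. 5 I.4, I.11.
-/

set_option autoImplicit false
set_option linter.dupNamespace false

noncomputable section

open scoped Matrix Kronecker TensorProduct Classical RestrictedProduct MatrixGroups
open NumberField IsDedekindDomain Filter Set MulAction MeasureTheory
open Literature.NumberTheory Literature.NumberTheory.Automorphic Literature.NumberTheory.Automorphic.UnitaryGroup
open Literature.NumberTheory.Automorphic.IdeleClassGroup
open Literature.NumberTheory.GelbartRogawski1991 Literature.NumberTheory.GelbartRogawski1991.UnitaryDualPair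
open Literature.NumberTheory.GelbartRogawski1991.UnitaryDualPair.WeilCoinv
open Literature.NumberTheory.GelbartRogawski1991.UnitaryDualPair.LocalSplitting
open Literature.NumberTheory.GelbartRogawski1991.GRConstruction
open Literature.NumberTheory.Weil1964 Literature.RepresentationTheory
open Literature.RepresentationTheory.HeisenbergGroup
open Literature.NumberTheory.GaloisRepresentations Literature.RepresentationTheory.HarrisKudlaSweet1996
open Literature.NumberTheory.GaloisRepresentations.IsNonarchimedeanLocalField
open Literature.NumberTheory.Automorphic.Liu2021 Literature.NumberTheory.Automorphic.Liu2021.Def411WeilCarriers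
open Literature.NumberTheory.Automorphic.Liu2021.Def411WeilCarriersDoubling
open Literature.RepresentationTheory.Liu2021
open Summit.HodgeConjecture.HodgeConjecture.Cruxes.HLiu418.K2LiuInertWeilSphericalLine
open Summit.HodgeConjecture.HodgeConjecture.Cruxes.HLiu418.K2LiuThetaTypeInertGlobalAssembly
open Summit.HodgeConjecture.HodgeConjecture.Cruxes.HLiu418.K2LiuThetaTypeSphericalEigenvaluesSplit

namespace Summit.HodgeConjecture.HodgeConjecture.Cruxes.HLiu418.K2LiuThetaTypeSphericalEigenvalueInertOfUpstairs

set_option maxHeartbeats 800000 in -- measured: > 400 000 (as ★ S4c-G∕S4c-H): the `θ`-package place-`v` carrier under 25 binders; ONE instantiation each of ★ (L24-a) and ★ `heckeOperator_apply_eq_smul_of_fixedPoints_le_span`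
/-- **The LOCAL eigen-equation on the place-`v` θ-factor from an UPSTAIRS equation** (the `hloc` of ★ `rhoVAtLine_heckeOperator_inclPlace_apply_eq_smul`): at a
non-split `v` with #28i's integral hyperbolic frame and the six side conditions (`2`, `imagUnit`, `ψ_v`, `𝕋₀_v`, Ω1, `a`), if `[U(𝒪_v) t U(𝒪_v)]` multiplies
`1_{𝒪_v^{n′}}` by `c₀` in `ω_v ∘ localLineInl v`, then it multiplies EVERY `U(𝒪_v)`-fixed vector of the θ-factor `(TwistedCoinv.rep χ_v ω_v _) ∘ localLineInl v` by `c₀`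
((L24-a) ★ `fixedPoints_twistedCoinv_omegaLoc_comp_localLineInl_le_span_inert` + ★ `heckeOperator_apply_eq_smul_of_fixedPoints_le_span`).
[cite: MoeglinVignerasWaldspurger1987, Chap. 5 I.11] [cite: Liu2021, Def. 4.11 (l. 2092–2096)] -/
theorem hloc_inert_of_upstairs (L : Type) [Field L] [NumberField L] [IsCMField L]
    (dV : Fin 2 → L) (hdV : ∀ i, IsCMField.complexConj L (dV i) = dV i) (hdV0 : ∀ i, dV i ≠ 0)
    {n' : ℕ} (e₁ : Fin 2 × Fin 1 ≃ Fin n')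
    (lam : Literature.NumberTheory.Automorphic.IdeleClassGroup L →ₜ* Circle) (hlam : IsConjugateSymplectic L lam)
    (a : (Fp L)ˣ) (χ : Chi (Fp L) L (IsCMField.complexConj L))
    (v : HeightOneSpectrum (𝓞 (Fp L))) (w : UnitaryGroup.PlacesOver L v) (hw : IsCMField.complexConj L • w.1 = w.1)
    (T : GL (Fin 2) (w.1.adicCompletion L)) (hTi : T ∈ glInt 2 (w.1.adicCompletion L))
    (hTJ : UnitaryGroup.placeForm (Matrix.diagonal dV) w.1 =
      formCongr (galAdicCompletionMap (L := L) (IsCMField.complexConj L) hw) T ((StdForm.antidiagonal 2).over (w.1.adicCompletion L)))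
    (g1 : Valued.v (2 : v.adicCompletion (Fp L)) = 1)
    (g2 : ∀ w' : UnitaryGroup.PlacesOver L v, Valued.v (algebraMap L (UnitaryGroup.LocalRing L v) (imagUnit L) w') = 1)
    (g3 : (adeleAddCharAt (Fp L) v).HasConductorExp 0)
    (g4 : ∀ i k, localGram (Fp L) n' (gram (Fp L) e₁ (realDiagonal L dV hdV) (TW (Fp L) a)) v i k ∈ primePowBall (v.adicCompletion (Fp L)) 0)
    (g5 : unitVec (Fp L) (Fin n') v ∈ ((congrW L e₁ dV hdV (lineW L (TW (Fp L) a)) (complexConj_lineW L (TW (Fp L) a)) (realDiagonal_lineW L (TW (Fp L) a))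
              (diagonal_lineW L (TW (Fp L) a) (JW_eq (Fp L) L a))
              (undoubledSplittings L e₁ dV hdV hdV0 (lineW L (TW (Fp L) a)) (complexConj_lineW L (TW (Fp L) a))
                (lineW_ne_zero L (TW (Fp L) a) (isUnit_det_TW (Fp L) a)) (toHeckeCharacter L lam) (borelPlaceMeasure L)
                (cmFinLocalFamily L e₁ dV hdV hdV0 (lineW L (TW (Fp L) a)) (complexConj_lineW L (TW (Fp L) a))
                  (lineW_ne_zero L (TW (Fp L) a) (isUnit_det_TW (Fp L) a)) (toHeckeCharacter L lam)
                  ((isOscillatorChar_toHeckeCharacter_iff lam).mpr hlam) (borelPlaceMeasure L)))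
              (isSymm_TW (Fp L) a) (JW_eq (Fp L) L a)).omegaLoc v).fixedPoints
        (UnitaryGroup.localInt L (IsCMField.complexConj L) n' (Matrix.reindex e₁ e₁ (Matrix.diagonal dV ⊗ₖ JW (Fp L) L a)) v))
    (g6 : Valued.v (((algebraMap (Fp L) L (a : Fp L) : L) : w.1.adicCompletion L)) = 1)
    (t : UnitaryGroup.localPi L (IsCMField.complexConj L) 2 (Matrix.diagonal dV) v) (c₀ : ℂ)
    (hup : heckeOperator (((congrW L e₁ dV hdV (lineW L (TW (Fp L) a)) (complexConj_lineW L (TW (Fp L) a)) (realDiagonal_lineW L (TW (Fp L) a))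
              (diagonal_lineW L (TW (Fp L) a) (JW_eq (Fp L) L a))
              (undoubledSplittings L e₁ dV hdV hdV0 (lineW L (TW (Fp L) a)) (complexConj_lineW L (TW (Fp L) a))
                (lineW_ne_zero L (TW (Fp L) a) (isUnit_det_TW (Fp L) a)) (toHeckeCharacter L lam) (borelPlaceMeasure L)
                (cmFinLocalFamily L e₁ dV hdV hdV0 (lineW L (TW (Fp L) a)) (complexConj_lineW L (TW (Fp L) a))
                  (lineW_ne_zero L (TW (Fp L) a) (isUnit_det_TW (Fp L) a)) (toHeckeCharacter L lam)
                  ((isOscillatorChar_toHeckeCharacter_iff lam).mpr hlam) (borelPlaceMeasure L)))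
              (isSymm_TW (Fp L) a) (JW_eq (Fp L) L a)).omegaLoc v).comp (localLineInl L (IsCMField.complexConj L) 2 e₁ (Matrix.diagonal dV) (JW (Fp L) L a) v))
        (UnitaryGroup.localInt L (IsCMField.complexConj L) 2 (Matrix.diagonal dV) v) t (unitVec (Fp L) (Fin n') v) = c₀ • unitVec (Fp L) (Fin n') v) :
    ∀ y ∈ Representation.fixedPoints
        (show Representation ℂ (UnitaryGroup.localPi L (IsCMField.complexConj L) 2 (Matrix.diagonal dV) v) _ from
          (TwistedCoinv.rep (localCharOfCenter (Fp L) L (IsCMField.complexConj L) (JW (Fp L) L a)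
            (JW_apply_ne_zero (Fp L) L a) χ.1 v) ((congrW L e₁ dV hdV (lineW L (TW (Fp L) a)) (complexConj_lineW L (TW (Fp L) a)) (realDiagonal_lineW L (TW (Fp L) a))
              (diagonal_lineW L (TW (Fp L) a) (JW_eq (Fp L) L a))
              (undoubledSplittings L e₁ dV hdV hdV0 (lineW L (TW (Fp L) a)) (complexConj_lineW L (TW (Fp L) a))
                (lineW_ne_zero L (TW (Fp L) a) (isUnit_det_TW (Fp L) a)) (toHeckeCharacter L lam) (borelPlaceMeasure L)
                (cmFinLocalFamily L e₁ dV hdV hdV0 (lineW L (TW (Fp L) a)) (complexConj_lineW L (TW (Fp L) a))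
                  (lineW_ne_zero L (TW (Fp L) a) (isUnit_det_TW (Fp L) a)) (toHeckeCharacter L lam)
                  ((isOscillatorChar_toHeckeCharacter_iff lam).mpr hlam) (borelPlaceMeasure L)))
              (isSymm_TW (Fp L) a) (JW_eq (Fp L) L a)).omegaLoc v)
          (commute_omegaLoc_localCenter (Fp L) L (IsCMField.complexConj L) 2 e₁ (Matrix.diagonal dV) (JW (Fp L) L a)
            (complexConj_imagUnit L) (imagUnit_ne_zero L) (imagUnit_mul_self L) (realDiagonal_isSymm L dV hdV)
            (isSymm_TW (Fp L) a) (realDiagonal_map L dV hdV).symm (JW_eq (Fp L) L a) (JW_apply_ne_zero (Fp L) L a)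
            (congrW L e₁ dV hdV (lineW L (TW (Fp L) a)) (complexConj_lineW L (TW (Fp L) a)) (realDiagonal_lineW L (TW (Fp L) a))
              (diagonal_lineW L (TW (Fp L) a) (JW_eq (Fp L) L a))
              (undoubledSplittings L e₁ dV hdV hdV0 (lineW L (TW (Fp L) a)) (complexConj_lineW L (TW (Fp L) a))
                (lineW_ne_zero L (TW (Fp L) a) (isUnit_det_TW (Fp L) a)) (toHeckeCharacter L lam) (borelPlaceMeasure L)
                (cmFinLocalFamily L e₁ dV hdV hdV0 (lineW L (TW (Fp L) a)) (complexConj_lineW L (TW (Fp L) a))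
                  (lineW_ne_zero L (TW (Fp L) a) (isUnit_det_TW (Fp L) a)) (toHeckeCharacter L lam)
                  ((isOscillatorChar_toHeckeCharacter_iff lam).mpr hlam) (borelPlaceMeasure L)))
              (isSymm_TW (Fp L) a) (JW_eq (Fp L) L a)) v)).comp (localLineInl L (IsCMField.complexConj L) 2 e₁ (Matrix.diagonal dV) (JW (Fp L) L a) v))
        (UnitaryGroup.localInt L (IsCMField.complexConj L) 2 (Matrix.diagonal dV) v),
      heckeOperator
        (show Representation ℂ (UnitaryGroup.localPi L (IsCMField.complexConj L) 2 (Matrix.diagonal dV) v) _ from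
          (TwistedCoinv.rep (localCharOfCenter (Fp L) L (IsCMField.complexConj L) (JW (Fp L) L a)
            (JW_apply_ne_zero (Fp L) L a) χ.1 v) ((congrW L e₁ dV hdV (lineW L (TW (Fp L) a)) (complexConj_lineW L (TW (Fp L) a)) (realDiagonal_lineW L (TW (Fp L) a))
              (diagonal_lineW L (TW (Fp L) a) (JW_eq (Fp L) L a))
              (undoubledSplittings L e₁ dV hdV hdV0 (lineW L (TW (Fp L) a)) (complexConj_lineW L (TW (Fp L) a))
                (lineW_ne_zero L (TW (Fp L) a) (isUnit_det_TW (Fp L) a)) (toHeckeCharacter L lam) (borelPlaceMeasure L)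
                (cmFinLocalFamily L e₁ dV hdV hdV0 (lineW L (TW (Fp L) a)) (complexConj_lineW L (TW (Fp L) a))
                  (lineW_ne_zero L (TW (Fp L) a) (isUnit_det_TW (Fp L) a)) (toHeckeCharacter L lam)
                  ((isOscillatorChar_toHeckeCharacter_iff lam).mpr hlam) (borelPlaceMeasure L)))
              (isSymm_TW (Fp L) a) (JW_eq (Fp L) L a)).omegaLoc v)
          (commute_omegaLoc_localCenter (Fp L) L (IsCMField.complexConj L) 2 e₁ (Matrix.diagonal dV) (JW (Fp L) L a)
            (complexConj_imagUnit L) (imagUnit_ne_zero L) (imagUnit_mul_self L) (realDiagonal_isSymm L dV hdV)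
            (isSymm_TW (Fp L) a) (realDiagonal_map L dV hdV).symm (JW_eq (Fp L) L a) (JW_apply_ne_zero (Fp L) L a)
            (congrW L e₁ dV hdV (lineW L (TW (Fp L) a)) (complexConj_lineW L (TW (Fp L) a)) (realDiagonal_lineW L (TW (Fp L) a))
              (diagonal_lineW L (TW (Fp L) a) (JW_eq (Fp L) L a))
              (undoubledSplittings L e₁ dV hdV hdV0 (lineW L (TW (Fp L) a)) (complexConj_lineW L (TW (Fp L) a))
                (lineW_ne_zero L (TW (Fp L) a) (isUnit_det_TW (Fp L) a)) (toHeckeCharacter L lam) (borelPlaceMeasure L)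
                (cmFinLocalFamily L e₁ dV hdV hdV0 (lineW L (TW (Fp L) a)) (complexConj_lineW L (TW (Fp L) a))
                  (lineW_ne_zero L (TW (Fp L) a) (isUnit_det_TW (Fp L) a)) (toHeckeCharacter L lam)
                  ((isOscillatorChar_toHeckeCharacter_iff lam).mpr hlam) (borelPlaceMeasure L)))
              (isSymm_TW (Fp L) a) (JW_eq (Fp L) L a)) v)).comp (localLineInl L (IsCMField.complexConj L) 2 e₁ (Matrix.diagonal dV) (JW (Fp L) L a) v))
        (UnitaryGroup.localInt L (IsCMField.complexConj L) 2 (Matrix.diagonal dV) v) t y = c₀ • y := by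
  classical
  haveI : NeZero n' := ⟨(Fin.pos (e₁ (0, 0))).ne'⟩
  have hc : IsCMField.complexConj L ≠ 1 := IsCMField.complexConj_ne_one L
  have hT₀d : IsUnit (gram (Fp L) e₁ (realDiagonal L dV hdV) (TW (Fp L) a)).det :=
    isUnit_det_gram (Fp L) e₁ (isUnit_det_realDiagonal L dV hdV hdV0) (isUnit_det_TW (Fp L) a)
  have hJh : ((Matrix.reindex e₁ e₁ (Matrix.diagonal dV ⊗ₖ JW (Fp L) L a)).map (IsCMField.complexConj L))ᵀ =
      Matrix.reindex e₁ e₁ (Matrix.diagonal dV ⊗ₖ JW (Fp L) L a) := by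
    rw [reindex_kronecker_eq_gram_map (Fp L) L e₁ (realDiagonal_map L dV hdV).symm (JW_eq (Fp L) L a)]
    ext i k
    simp only [Matrix.transpose_apply, Matrix.map_apply, AlgEquiv.commutes]
    rw [(isSymm_gram (Fp L) e₁ (realDiagonal_isSymm L dV hdV) (isSymm_TW (Fp L) a)).apply i k]
  -- the `W`-scalar `a` read at `w`
  have hJW : UnitaryGroup.placeForm (JW (Fp L) L a) w.1 =
      Matrix.of fun _ _ : Fin 1 => ((algebraMap (Fp L) L (a : Fp L) : L) : w.1.adicCompletion L) := by
    refine Matrix.ext fun i k => ?_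
    fin_cases i; fin_cases k
    simp only [UnitaryGroup.placeForm, JW_eq, TW, Matrix.map_apply, Matrix.of_apply, Matrix.cons_val', Matrix.cons_val_fin_one,
      Matrix.empty_val', HeightOneSpectrum.algebraMap_adicCompletion, Function.comp_apply, Algebra.algebraMap_self, RingHom.id_apply]
  have hσa : galAdicCompletionMap (L := L) (IsCMField.complexConj L) hw
      ((algebraMap (Fp L) L (a : Fp L) : L) : w.1.adicCompletion L) = ((algebraMap (Fp L) L (a : Fp L) : L) : w.1.adicCompletion L) :=
    by rw [galAdicCompletionMap_algebraMap]
  -- (L24-a): the line for the place-`v` θ-factor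
  have hline := fixedPoints_twistedCoinv_omegaLoc_comp_localLineInl_le_span_inert (F := Fp L) L (IsCMField.complexConj L) hc e₁
    (Matrix.diagonal dV) (JW (Fp L) L a) (JW_apply_ne_zero (Fp L) L a) (complexConj_imagUnit L) (imagUnit_ne_zero L) (imagUnit_mul_self L)
    (gram (Fp L) e₁ (realDiagonal L dV hdV) (TW (Fp L) a)) (isSymm_gram (Fp L) e₁ (realDiagonal_isSymm L dV hdV) (isSymm_TW (Fp L) a))
    (reindex_kronecker_eq_gram_map (Fp L) L e₁ (realDiagonal_map L dV hdV).symm (JW_eq (Fp L) L a)) hJh v w hw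
    (congrW L e₁ dV hdV (lineW L (TW (Fp L) a)) (complexConj_lineW L (TW (Fp L) a)) (realDiagonal_lineW L (TW (Fp L) a))
              (diagonal_lineW L (TW (Fp L) a) (JW_eq (Fp L) L a))
              (undoubledSplittings L e₁ dV hdV hdV0 (lineW L (TW (Fp L) a)) (complexConj_lineW L (TW (Fp L) a))
                (lineW_ne_zero L (TW (Fp L) a) (isUnit_det_TW (Fp L) a)) (toHeckeCharacter L lam) (borelPlaceMeasure L)
                (cmFinLocalFamily L e₁ dV hdV hdV0 (lineW L (TW (Fp L) a)) (complexConj_lineW L (TW (Fp L) a))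
                  (lineW_ne_zero L (TW (Fp L) a) (isUnit_det_TW (Fp L) a)) (toHeckeCharacter L lam)
                  ((isOscillatorChar_toHeckeCharacter_iff lam).mpr hlam) (borelPlaceMeasure L)))
              (isSymm_TW (Fp L) a) (JW_eq (Fp L) L a))
    hT₀d g1 g2 g3 g4 g5 _ hJW hσa g6 T hTi hTJ
    (localCharOfCenter (Fp L) L (IsCMField.complexConj L) (JW (Fp L) L a) (JW_apply_ne_zero (Fp L) L a) χ.1 v)
    (commute_omegaLoc_localCenter (Fp L) L (IsCMField.complexConj L) 2 e₁ (Matrix.diagonal dV) (JW (Fp L) L a)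
      (complexConj_imagUnit L) (imagUnit_ne_zero L) (imagUnit_mul_self L) (realDiagonal_isSymm L dV hdV)
      (isSymm_TW (Fp L) a) (realDiagonal_map L dV hdV).symm (JW_eq (Fp L) L a) (JW_apply_ne_zero (Fp L) L a)
      (congrW L e₁ dV hdV (lineW L (TW (Fp L) a)) (complexConj_lineW L (TW (Fp L) a)) (realDiagonal_lineW L (TW (Fp L) a))
              (diagonal_lineW L (TW (Fp L) a) (JW_eq (Fp L) L a))
              (undoubledSplittings L e₁ dV hdV hdV0 (lineW L (TW (Fp L) a)) (complexConj_lineW L (TW (Fp L) a))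
                (lineW_ne_zero L (TW (Fp L) a) (isUnit_det_TW (Fp L) a)) (toHeckeCharacter L lam) (borelPlaceMeasure L)
                (cmFinLocalFamily L e₁ dV hdV hdV0 (lineW L (TW (Fp L) a)) (complexConj_lineW L (TW (Fp L) a))
                  (lineW_ne_zero L (TW (Fp L) a) (isUnit_det_TW (Fp L) a)) (toHeckeCharacter L lam)
                  ((isOscillatorChar_toHeckeCharacter_iff lam).mpr hlam) (borelPlaceMeasure L)))
              (isSymm_TW (Fp L) a) (JW_eq (Fp L) L a)) v)
  -- the upstairs equation + the line ⇒ the LOCAL eigen-equation on the place-`v` factor (carriers given explicitly: no higher-order unification)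
  refine heckeOperator_apply_eq_smul_of_fixedPoints_le_span (((congrW L e₁ dV hdV (lineW L (TW (Fp L) a)) (complexConj_lineW L (TW (Fp L) a)) (realDiagonal_lineW L (TW (Fp L) a))
              (diagonal_lineW L (TW (Fp L) a) (JW_eq (Fp L) L a))
              (undoubledSplittings L e₁ dV hdV hdV0 (lineW L (TW (Fp L) a)) (complexConj_lineW L (TW (Fp L) a))
                (lineW_ne_zero L (TW (Fp L) a) (isUnit_det_TW (Fp L) a)) (toHeckeCharacter L lam) (borelPlaceMeasure L)
                (cmFinLocalFamily L e₁ dV hdV hdV0 (lineW L (TW (Fp L) a)) (complexConj_lineW L (TW (Fp L) a))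
                  (lineW_ne_zero L (TW (Fp L) a) (isUnit_det_TW (Fp L) a)) (toHeckeCharacter L lam)
                  ((isOscillatorChar_toHeckeCharacter_iff lam).mpr hlam) (borelPlaceMeasure L)))
              (isSymm_TW (Fp L) a) (JW_eq (Fp L) L a)).omegaLoc v).comp (localLineInl L (IsCMField.complexConj L) 2 e₁ (Matrix.diagonal dV) (JW (Fp L) L a) v))
    (show Representation ℂ (UnitaryGroup.localPi L (IsCMField.complexConj L) 2 (Matrix.diagonal dV) v) _ from
      (TwistedCoinv.rep (localCharOfCenter (Fp L) L (IsCMField.complexConj L) (JW (Fp L) L a)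
            (JW_apply_ne_zero (Fp L) L a) χ.1 v) ((congrW L e₁ dV hdV (lineW L (TW (Fp L) a)) (complexConj_lineW L (TW (Fp L) a)) (realDiagonal_lineW L (TW (Fp L) a))
              (diagonal_lineW L (TW (Fp L) a) (JW_eq (Fp L) L a))
              (undoubledSplittings L e₁ dV hdV hdV0 (lineW L (TW (Fp L) a)) (complexConj_lineW L (TW (Fp L) a))
                (lineW_ne_zero L (TW (Fp L) a) (isUnit_det_TW (Fp L) a)) (toHeckeCharacter L lam) (borelPlaceMeasure L)
                (cmFinLocalFamily L e₁ dV hdV hdV0 (lineW L (TW (Fp L) a)) (complexConj_lineW L (TW (Fp L) a))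
                  (lineW_ne_zero L (TW (Fp L) a) (isUnit_det_TW (Fp L) a)) (toHeckeCharacter L lam)
                  ((isOscillatorChar_toHeckeCharacter_iff lam).mpr hlam) (borelPlaceMeasure L)))
              (isSymm_TW (Fp L) a) (JW_eq (Fp L) L a)).omegaLoc v)
          (commute_omegaLoc_localCenter (Fp L) L (IsCMField.complexConj L) 2 e₁ (Matrix.diagonal dV) (JW (Fp L) L a)
            (complexConj_imagUnit L) (imagUnit_ne_zero L) (imagUnit_mul_self L) (realDiagonal_isSymm L dV hdV)
            (isSymm_TW (Fp L) a) (realDiagonal_map L dV hdV).symm (JW_eq (Fp L) L a) (JW_apply_ne_zero (Fp L) L a)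
            (congrW L e₁ dV hdV (lineW L (TW (Fp L) a)) (complexConj_lineW L (TW (Fp L) a)) (realDiagonal_lineW L (TW (Fp L) a))
              (diagonal_lineW L (TW (Fp L) a) (JW_eq (Fp L) L a))
              (undoubledSplittings L e₁ dV hdV hdV0 (lineW L (TW (Fp L) a)) (complexConj_lineW L (TW (Fp L) a))
                (lineW_ne_zero L (TW (Fp L) a) (isUnit_det_TW (Fp L) a)) (toHeckeCharacter L lam) (borelPlaceMeasure L)
                (cmFinLocalFamily L e₁ dV hdV hdV0 (lineW L (TW (Fp L) a)) (complexConj_lineW L (TW (Fp L) a))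
                  (lineW_ne_zero L (TW (Fp L) a) (isUnit_det_TW (Fp L) a)) (toHeckeCharacter L lam)
                  ((isOscillatorChar_toHeckeCharacter_iff lam).mpr hlam) (borelPlaceMeasure L)))
              (isSymm_TW (Fp L) a) (JW_eq (Fp L) L a)) v)).comp (localLineInl L (IsCMField.complexConj L) 2 e₁ (Matrix.diagonal dV) (JW (Fp L) L a) v))
    (TwistedCoinv.mk _ (localCharOfCenter (Fp L) L (IsCMField.complexConj L) (JW (Fp L) L a) (JW_apply_ne_zero (Fp L) L a) χ.1 v))
    (fun x f => ?_) (UnitaryGroup.localInt L (IsCMField.complexConj L) 2 (Matrix.diagonal dV) v) t (finite_orbit_localInt v t)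
    (unitVec (Fp L) (Fin n') v) c₀ hline hup
  rw [MonoidHom.comp_apply, MonoidHom.comp_apply]
  exact (TwistedCoinv.rep_mk _ _ _ _ f).symm

set_option maxHeartbeats 400000 in -- measured: > 200 000 (as ★ S4c-G∕S4c-H): the `θ`-package carriers of #24i under 30 binders; ONE instantiation each of ★ global assembly and ★ pull-back
/-- **Socket #24i MODULO (Σ).**  If, off a finite set of places of `L` and under #28i's place∕frame∕generator block, the UPSTAIRS Hecke operator
`[U(𝒪_v) t₁ U(𝒪_v)]` of `ω_v ∘ localLineInl v` multiplies `1_{𝒪_v^{n′}}` by `q(Z + Z⁻¹) + q − 1` (`Z := (toHeckeCharacter L lam).valueAtUniformizer w.1`; hypothesis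
(Σ), organ (L24-b)), then the statement of socket #24i `sig_K2LiuThetaTypeSphericalEigenvalueInert` holds VERBATIM: for every `σ ↪ ω⋆` (injective `j`) there is a finite
`S₀` off which, at every inert unramified non-dyadic good `v` with #28i's frame and every `K` hyperspecial at `v`, `heckeOperator σ K (ι_v t₁) y = (q(Z+Z⁻¹)+q−1) • y`
on `σ^K` ((L24-a) line ⇒ `hloc` ⇒ S4c-H global ⇒ pull-back along `j`). [cite: Liu2021, Def. 4.11 (l. 2083–2097); App. D Lem. D.1 (l. 5226–5233)]
[cite: GelbartRogawski1991, §3 pp. 455–459] [cite: CartierCorvallis1979, §IV.1] [cite: MoeglinVignerasWaldspurger1987, Chap. 5 I.11] -/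
theorem thetaTypeSphericalEigenvalueInert_of_upstairs :
    ∀ (L : Type) [Field L] [NumberField L] [IsCMField L]
      (dV : Fin 2 → L) (hdV : ∀ i, IsCMField.complexConj L (dV i) = dV i) (hdV0 : ∀ i, dV i ≠ 0)
      {n' : ℕ} (e₁ : Fin 2 × Fin 1 ≃ Fin n')
      (lam : Literature.NumberTheory.Automorphic.IdeleClassGroup L →ₜ* Circle) (hlam : IsConjugateSymplectic L lam)
      (a : (↥(maximalRealSubfield L))ˣ) (χ : Chi (↥(maximalRealSubfield L)) L (IsCMField.complexConj L))
      (W : Type) [AddCommGroup W] [Module ℂ W]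
      (σ : Representation ℂ (finAdelic (↥(maximalRealSubfield L)) L (IsCMField.complexConj L) 2 (Matrix.diagonal dV)) W)
      (j : σ.IntertwiningMap
        (rhoVAtLine (↥(maximalRealSubfield L)) L (IsCMField.complexConj L) 2 e₁ (Matrix.diagonal dV)
            (complexConj_imagUnit L) (imagUnit_ne_zero L) (imagUnit_mul_self L) (realDiagonal_isSymm L dV hdV)
            (isUnit_det_realDiagonal L dV hdV hdV0) (realDiagonal_map L dV hdV).symm
            (fun a => isCompatible_chiSplittingLine L e₁ dV hdV hdV0 (toHeckeCharacter L lam)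
              (isUnitary_toHeckeCharacter L lam) ((isOscillatorChar_toHeckeCharacter_iff lam).mpr hlam)
              (TW (↥(maximalRealSubfield L)) a) (isSymm_TW (↥(maximalRealSubfield L)) a)
              (isUnit_det_TW (↥(maximalRealSubfield L)) a) (JW (↥(maximalRealSubfield L)) L a)
              (JW_eq (↥(maximalRealSubfield L)) L a)) a χ)),
      Function.Injective j →
      -- (Σ): the UPSTAIRS Hecke computation on `1_{𝒪ⁿ′}` for `ω_v ∘ localLineInl v`, off a finite set, under #28i's place∕frame∕generator block
      (∃ S₂ : Set (HeightOneSpectrum (𝓞 L)), S₂.Finite ∧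
        ∀ (v : HeightOneSpectrum (𝓞 (Fp L))) (w : UnitaryGroup.PlacesOver L v), w.1 ∉ S₂ →
          ∀ (_hw : IsCMField.complexConj L • w.1 = w.1) (_hv : Algebra.IsUnramifiedIn (𝓞 L) v.asIdeal)
            (_h2 : ∀ w' : UnitaryGroup.PlacesOver L v, ValuativeRel.valuation (w'.1.adicCompletion L) (2 : w'.1.adicCompletion L) = 1)
            (_hdVw : ∀ (w' : UnitaryGroup.PlacesOver L v) (i : Fin 2),
              ValuativeRel.valuation (w'.1.adicCompletion L) (algebraMap L (w'.1.adicCompletion L) (dV i)) = 1)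
            (ϖ : w.1.adicCompletion L) (_hϖ : Valued.v ϖ = WithZero.exp (-1 : ℤ))
            (_hϖσ : galAdicCompletionMap (L := L) (IsCMField.complexConj L) _hw ϖ = ϖ)
            (T : GL (Fin 2) (w.1.adicCompletion L)) (_hTi : T ∈ glInt 2 (w.1.adicCompletion L))
            (_hTJ : UnitaryGroup.placeForm (Matrix.diagonal dV) w.1 =
              formCongr (galAdicCompletionMap (L := L) (IsCMField.complexConj L) _hw) T ((StdForm.antidiagonal 2).over (w.1.adicCompletion L)))
            (t₁ : UnitaryGroup.localPi L (IsCMField.complexConj L) 2 (Matrix.diagonal dV) v)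
            (_ht₁ : (((t₁ : UnitaryGroup.LocalGLPi L 2 v) w : GL (Fin 2) (w.1.adicCompletion L)) : Matrix (Fin 2) (Fin 2) (w.1.adicCompletion L)) =
              ((T⁻¹ : GL (Fin 2) (w.1.adicCompletion L)) : Matrix (Fin 2) (Fin 2) (w.1.adicCompletion L)) *
                Matrix.diagonal ![ϖ, ϖ⁻¹] * (T : Matrix (Fin 2) (Fin 2) (w.1.adicCompletion L))),
            heckeOperator (((congrW L e₁ dV hdV (lineW L (TW (Fp L) a)) (complexConj_lineW L (TW (Fp L) a)) (realDiagonal_lineW L (TW (Fp L) a))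
              (diagonal_lineW L (TW (Fp L) a) (JW_eq (Fp L) L a))
              (undoubledSplittings L e₁ dV hdV hdV0 (lineW L (TW (Fp L) a)) (complexConj_lineW L (TW (Fp L) a))
                (lineW_ne_zero L (TW (Fp L) a) (isUnit_det_TW (Fp L) a)) (toHeckeCharacter L lam) (borelPlaceMeasure L)
                (cmFinLocalFamily L e₁ dV hdV hdV0 (lineW L (TW (Fp L) a)) (complexConj_lineW L (TW (Fp L) a))
                  (lineW_ne_zero L (TW (Fp L) a) (isUnit_det_TW (Fp L) a)) (toHeckeCharacter L lam)
                  ((isOscillatorChar_toHeckeCharacter_iff lam).mpr hlam) (borelPlaceMeasure L)))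
              (isSymm_TW (Fp L) a) (JW_eq (Fp L) L a)).omegaLoc v).comp (localLineInl L (IsCMField.complexConj L) 2 e₁ (Matrix.diagonal dV) (JW (Fp L) L a) v))
                (UnitaryGroup.localInt L (IsCMField.complexConj L) 2 (Matrix.diagonal dV) v) t₁ (unitVec (Fp L) (Fin n') v) =
              ((v.residueCard : ℂ) *
                      ((toHeckeCharacter L lam).valueAtUniformizer w.1 + ((toHeckeCharacter L lam).valueAtUniformizer w.1)⁻¹) +
                    (v.residueCard : ℂ) - 1) • unitVec (Fp L) (Fin n') v) →
      ∃ S₀ : Set (HeightOneSpectrum (𝓞 L)), S₀.Finite ∧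
        ∀ (v : HeightOneSpectrum (𝓞 (Fp L))) (w : UnitaryGroup.PlacesOver L v), w.1 ∉ S₀ →
          ∀ (_hw : IsCMField.complexConj L • w.1 = w.1) (_hv : Algebra.IsUnramifiedIn (𝓞 L) v.asIdeal)
            (_h2 : ∀ w' : UnitaryGroup.PlacesOver L v, ValuativeRel.valuation (w'.1.adicCompletion L) (2 : w'.1.adicCompletion L) = 1)
            (_hdVw : ∀ (w' : UnitaryGroup.PlacesOver L v) (i : Fin 2),
              ValuativeRel.valuation (w'.1.adicCompletion L) (algebraMap L (w'.1.adicCompletion L) (dV i)) = 1)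
            (ϖ : w.1.adicCompletion L) (_hϖ : Valued.v ϖ = WithZero.exp (-1 : ℤ))
            (_hϖσ : galAdicCompletionMap (L := L) (IsCMField.complexConj L) _hw ϖ = ϖ)
            (T : GL (Fin 2) (w.1.adicCompletion L)) (_hTi : T ∈ glInt 2 (w.1.adicCompletion L))
            (_hTJ : UnitaryGroup.placeForm (Matrix.diagonal dV) w.1 =
              formCongr (galAdicCompletionMap (L := L) (IsCMField.complexConj L) _hw) T ((StdForm.antidiagonal 2).over (w.1.adicCompletion L)))
            (t₁ : UnitaryGroup.localPi L (IsCMField.complexConj L) 2 (Matrix.diagonal dV) v)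
            (_ht₁ : (((t₁ : UnitaryGroup.LocalGLPi L 2 v) w : GL (Fin 2) (w.1.adicCompletion L)) : Matrix (Fin 2) (Fin 2) (w.1.adicCompletion L)) =
              ((T⁻¹ : GL (Fin 2) (w.1.adicCompletion L)) : Matrix (Fin 2) (Fin 2) (w.1.adicCompletion L)) *
                Matrix.diagonal ![ϖ, ϖ⁻¹] * (T : Matrix (Fin 2) (Fin 2) (w.1.adicCompletion L)))
            (K : Subgroup ↥(finAdelic ↥(maximalRealSubfield L) L (IsCMField.complexConj L) 2 (Matrix.diagonal dV))),
            UnitaryGroup.IsHyperspecialAt ↥(maximalRealSubfield L) L (IsCMField.complexConj L) 2 (Matrix.diagonal dV) K v →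
            ∀ y ∈ σ.fixedPoints K,
              heckeOperator σ K
                  (UnitaryGroup.inclPlace ↥(maximalRealSubfield L) L (IsCMField.complexConj L) 2 (Matrix.diagonal dV) v t₁) y =
                ((v.residueCard : ℂ) *
                      ((toHeckeCharacter L lam).valueAtUniformizer w.1 + ((toHeckeCharacter L lam).valueAtUniformizer w.1)⁻¹) +
                    (v.residueCard : ℂ) - 1) • y := by
  intro L _ _ _ dV hdV hdV0 n' e₁ lam hlam a χ W _ _ σ j hj hup
  classical
  haveI : NeZero n' := ⟨(Fin.pos (e₁ (0, 0))).ne'⟩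
  have hc : IsCMField.complexConj L ≠ 1 := IsCMField.complexConj_ne_one L
  obtain ⟨S₂, hS₂f, hup⟩ := hup
  have haL : (algebraMap (Fp L) L (a : Fp L) : L) ≠ 0 := (map_ne_zero _).2 a.ne_zero
  -- the cofinite side conditions, at the places of `L⁺` and then at the places of `L`
  have hgood : ∀ᶠ v : HeightOneSpectrum (𝓞 (Fp L)) in cofinite,
      Valued.v (2 : v.adicCompletion (Fp L)) = 1 ∧
      (∀ w' : UnitaryGroup.PlacesOver L v, Valued.v (algebraMap L (UnitaryGroup.LocalRing L v) (imagUnit L) w') = 1) ∧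
      (adeleAddCharAt (Fp L) v).HasConductorExp 0 ∧
      (∀ i k, localGram (Fp L) n' (gram (Fp L) e₁ (realDiagonal L dV hdV) (TW (Fp L) a)) v i k ∈ primePowBall (v.adicCompletion (Fp L)) 0) ∧
      unitVec (Fp L) (Fin n') v ∈ ((congrW L e₁ dV hdV (lineW L (TW (Fp L) a)) (complexConj_lineW L (TW (Fp L) a)) (realDiagonal_lineW L (TW (Fp L) a))
              (diagonal_lineW L (TW (Fp L) a) (JW_eq (Fp L) L a))
              (undoubledSplittings L e₁ dV hdV hdV0 (lineW L (TW (Fp L) a)) (complexConj_lineW L (TW (Fp L) a))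
                (lineW_ne_zero L (TW (Fp L) a) (isUnit_det_TW (Fp L) a)) (toHeckeCharacter L lam) (borelPlaceMeasure L)
                (cmFinLocalFamily L e₁ dV hdV hdV0 (lineW L (TW (Fp L) a)) (complexConj_lineW L (TW (Fp L) a))
                  (lineW_ne_zero L (TW (Fp L) a) (isUnit_det_TW (Fp L) a)) (toHeckeCharacter L lam)
                  ((isOscillatorChar_toHeckeCharacter_iff lam).mpr hlam) (borelPlaceMeasure L)))
              (isSymm_TW (Fp L) a) (JW_eq (Fp L) L a)).omegaLoc v).fixedPoints
          (UnitaryGroup.localInt L (IsCMField.complexConj L) n' (Matrix.reindex e₁ e₁ (Matrix.diagonal dV ⊗ₖ JW (Fp L) L a)) v) ∧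
      (∀ w' : UnitaryGroup.PlacesOver L v, Valued.v (algebraMap L (w'.1.adicCompletion L) (algebraMap (Fp L) L (a : Fp L))) = 1) := by
    filter_upwards [eventually_valued_two_eq_one' (Fp L), eventually_forall_valued_delta_eq_one (F := Fp L) L (imagUnit_ne_zero L),
      eventually_hasConductorExp_zero_adeleAddCharAt (Fp L),
      eventually_forall_localGram_mem (F := Fp L) (gram (Fp L) e₁ (realDiagonal L dV hdV) (TW (Fp L) a)),
      ((congrW L e₁ dV hdV (lineW L (TW (Fp L) a)) (complexConj_lineW L (TW (Fp L) a)) (realDiagonal_lineW L (TW (Fp L) a))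
              (diagonal_lineW L (TW (Fp L) a) (JW_eq (Fp L) L a))
              (undoubledSplittings L e₁ dV hdV hdV0 (lineW L (TW (Fp L) a)) (complexConj_lineW L (TW (Fp L) a))
                (lineW_ne_zero L (TW (Fp L) a) (isUnit_det_TW (Fp L) a)) (toHeckeCharacter L lam) (borelPlaceMeasure L)
                (cmFinLocalFamily L e₁ dV hdV hdV0 (lineW L (TW (Fp L) a)) (complexConj_lineW L (TW (Fp L) a))
                  (lineW_ne_zero L (TW (Fp L) a) (isUnit_det_TW (Fp L) a)) (toHeckeCharacter L lam)
                  ((isOscillatorChar_toHeckeCharacter_iff lam).mpr hlam) (borelPlaceMeasure L)))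
              (isSymm_TW (Fp L) a) (JW_eq (Fp L) L a))).unitVec_mem_fixedPoints,
      UnitaryGroup.eventually_forall_placesOver (F := Fp L) L (UnitaryGroup.eventually_valued_algebraMap_eq_one L haL)]
      with v h1 h2 h3 h4 h5 h6
    exact ⟨h1, h2, h3, h4, h5, h6⟩
  have hgoodL := (tendsto_placesOver_cofinite (Fp L) L).eventually hgood
  refine ⟨S₂ ∪ _, hS₂f.union (Filter.eventually_cofinite.1 hgoodL), ?_⟩
  intro v w hwS hw hv h2' hdVw ϖ hϖ hϖσ T hTi hTJ t₁ ht₁ K hK y hy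
  simp only [Set.mem_union, Set.mem_setOf_eq, not_or, not_not] at hwS
  obtain ⟨hw₂, hG⟩ := hwS
  rw [show placesOver (Fp L) L w.1 = v from w.2] at hG
  obtain ⟨g1, g2, g3, g4, g5, g6⟩ := hG
  -- (L24-a) + (Σ) ⇒ the LOCAL eigen-equation on the place-`v` θ-factor
  have hloc := hloc_inert_of_upstairs L dV hdV hdV0 e₁ lam hlam a χ v w hw T hTi hTJ g1 g2 g3 g4 g5 (g6 w) t₁
    ((v.residueCard : ℂ) *
                      ((toHeckeCharacter L lam).valueAtUniformizer w.1 + ((toHeckeCharacter L lam).valueAtUniformizer w.1)⁻¹) +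
                    (v.residueCard : ℂ) - 1)
    (hup v w hw₂ hw hv h2' hdVw ϖ hϖ hϖσ T hTi hTJ t₁ ht₁)
  -- LOCAL ⇒ GLOBAL on `(ω⋆)^K` (S4c-H `⊗'` + hyperspecial glue), then pull back along the injective `j`
  have hj' := fun x u => Representation.IntertwiningMap.isIntertwining _ _ j x u
  exact heckeOperator_inclPlace_apply_eq_smul_of_injective σ _ j hj' hj hK t₁ _ hy
    (rhoVAtLine_heckeOperator_inclPlace_apply_eq_smul L e₁ dV hdV hdV0 (toHeckeCharacter L lam) (isUnitary_toHeckeCharacter L lam)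
      ((isOscillatorChar_toHeckeCharacter_iff lam).mpr hlam) a χ (borelPlaceMeasure L)
      (cmFinLocalFamily L e₁ dV hdV hdV0 (lineW L (TW (Fp L) a)) (complexConj_lineW L (TW (Fp L) a))
        (lineW_ne_zero L (TW (Fp L) a) (isUnit_det_TW (Fp L) a)) (toHeckeCharacter L lam)
        ((isOscillatorChar_toHeckeCharacter_iff lam).mpr hlam) (borelPlaceMeasure L))
      v K hK t₁ _ hloc (j y) (map_mem_fixedPoints σ _ j hj' K hy))

end Summit.HodgeConjecture.HodgeConjecture.Cruxes.HLiu418.K2LiuThetaTypeSphericalEigenvalueInertOfUpstairs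

end
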